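import Summits.CriticalPhenomena.PercolationContinuityZ3.Theorems.PercNearOneGluingNoHeavyQuantFarEarAtObserverReach
import HarnessLib

/-!
# QUANT lane R8, front "FAR beyond trees", layer one — THE HAIRED EAR AT THE OBSERVER, I: reachability and the relay count

builds on p205010 (kernel theorem, internal audit signed; external expert review pending)

Support file (`--supports stmt-CriticalPhenomena-4575`), seat `prim-quant-p1` (gen 27); memo
`run/shared/lean/prim/quant/prim-quant-p1-g27/FOR-LEAD-HAIR.md`.  Pure combinatorics of open paths (no measure); standard axioms;
no sorries; no definitions.

**Setting** (the hair generalisation of `…QuantFarEarAtObserverReach`, p1 g26 memo §6(b′)).  Vertices `Fin n`; the observer `o`;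
a relay `v` whose only positive pairs are `s(o,v)` and `s(v,u)` to a vertex `u` (arbitrary further pairs) that carries a PENDANT
relay `h` (only pair `s(u,h)`).  A configuration `ω` is GOOD when the other pairs at `v` and at `h` are absent (almost surely so).
Write `Z = {v, h}`, `x ~ y off Z` for reachability through the open pairs avoiding `Z` (`Bundle.offZ {v, h}`), `G = [o ~ u off Z]`.

* `EarHair.offZ_offZ` — `offZ {v} (offZ {h} ω) = offZ {v, h} ω`; the file then applies the one-vertex lemmas of
  `…EarAtObserverReach` twice (first at the pendant vertex `h`, then at `v`):
* **`EarHair.reach_iff_of_ne`**: for `x ∉ Z`, `o ↔ x ⟺ o ~ x off Z ∨ (s(o,v), s(v,u) open ∧ u ~ x off Z)`;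
  **`reach_v_iff`**: `o ↔ v ⟺ s(o,v) open ∨ (s(v,u) open ∧ G)`; **`reach_u_iff`**: `o ↔ u ⟺ (s(o,v), s(v,u) open) ∨ G`;
  **`reach_h_iff`**: `o ↔ h ⟺ s(u,h) open ∧ (G ∨ (s(o,v), s(v,u) open))`;
* **`EarHair.card_eq`** — the observer's relay count as a function of the three pairs `s(o,v)`, `s(v,u)`, `s(u,h)` and of the off-`Z`
  data `G`, `K = #{b ∈ A″ : o ~ b off Z}`, `F = #{b ∈ A″ : o ≁ b, u ~ b off Z}` (`A″ = A ∖ {v, h}`, relays `v, h ∈ A`);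
* **`EarHair.count_le`** — the pointwise first-moment bound `K + π F ≤ π n·[¬G, K = 0, F ≥ 1] + (1 − π + π n)·[¬G, K = 1]
  + n·[¬G, K ≥ 2] + [G, K = 1] + n·[G, K ≥ 2]` (`n = |A″|`, `0 ≤ π ≤ 1`).
[cite: Grimmett1999, §1.3 p. 10] (open paths / clusters); the bookkeeping is [this work].
-/

namespace Summit.CriticalPhenomena.PercolationContinuityZ3.Theorems

namespace Quant

namespace EarHair

open Finset
open Literature.Probability.Percolation
open Bundle (offZ offZ_subset reachable_of_offZ)
open scoped Classical

variable {n : ℕ} {o v u h : Fin n}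

/-! ## Stripping the two special vertices one at a time -/

/-- `offZ {v} (offZ {h} ω) = offZ {v, h} ω`. [this work] -/
theorem offZ_offZ (ω : BondConfig (Fin n)) : offZ {v} (offZ {h} ω) = offZ {v, h} ω := by
  ext e
  simp only [offZ, Set.mem_setOf_eq, Finset.mem_singleton, Finset.mem_insert, forall_eq_or_imp, forall_eq]
  tauto

/-- A pair not containing `z` survives the stripping of `z`. [this work] -/
theorem mem_offZ_singleton_iff {ω : BondConfig (Fin n)} {z : Fin n} {e : Sym2 (Fin n)} (hz : z ∉ e) :
    e ∈ offZ {z} ω ↔ e ∈ ω := by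
  simp only [offZ, Set.mem_setOf_eq, Finset.mem_singleton, forall_eq]
  exact ⟨fun h' => h'.1, fun h' => ⟨h', hz⟩⟩

section Good

variable {ω : BondConfig (Fin n)}
  (hωv : ∀ z : Fin n, z ≠ o → z ≠ u → z ≠ v → s(v, z) ∉ ω) (hωh : ∀ z : Fin n, z ≠ u → z ≠ h → s(h, z) ∉ ω)
  (hov : o ≠ v) (huv : u ≠ v) (hou : o ≠ u) (hoh : o ≠ h) (huh : u ≠ h) (hvh : v ≠ h)
include hωv hωh hov huv hou hoh huh hvh

omit hωv hov huv hou hoh huh hvh in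
/-- Goodness at `h` in the form used by `…EarAtObserverReach` (with `h` in the rôle of its `v`). [this work] -/
theorem good_h : ∀ z : Fin n, z ≠ o → z ≠ u → z ≠ h → s(h, z) ∉ ω := fun z _ hzu hzh => hωh z hzu hzh

omit hωh hov huv hou hoh huh hvh in
/-- Goodness at `v` survives the stripping of `h`. [this work] -/
theorem good_v_offZ : ∀ z : Fin n, z ≠ o → z ≠ u → z ≠ v → s(v, z) ∉ offZ {h} ω :=
  fun z h1 h2 h3 he => hωv z h1 h2 h3 (offZ_subset {h} ω he)

omit hωv hov huv huh hvh in
/-- The pair `s(o, h)` is absent on a good configuration. [this work] -/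
theorem not_mem_oh : s(o, h) ∉ ω := by
  rw [Sym2.eq_swap]; exact hωh o hou hoh

omit hωv hov huv hvh in
/-- **Vertices other than `h` are reached off `h`** (`h` is pendant at `u`). [this work] -/
theorem reach_iff_off_h {x : Fin n} (hx : x ≠ h) : (openGraph ω).Reachable o x ↔ (openGraph (offZ {h} ω)).Reachable o x := by
  rw [EarAtObserver.reach_iff_of_ne (o := o) (v := h) (u := u) (good_h (o := o) hωh) hoh huh hx]
  constructor
  · rintro (h' | ⟨hp, -, -⟩)
    · exact h'
    · exact absurd hp (not_mem_oh hωh hou hoh)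
  · exact fun h' => Or.inl h'

/-- **Vertices off `Z`.**  For `x ≠ v, h`: `o ↔ x ⟺ o ~ x off Z ∨ (s(o,v) ∈ ω ∧ s(v,u) ∈ ω ∧ u ~ x off Z)`. [this work] -/
theorem reach_iff_of_ne {x : Fin n} (hxv : x ≠ v) (hxh : x ≠ h) :
    (openGraph ω).Reachable o x ↔ (openGraph (offZ {v, h} ω)).Reachable o x ∨
      (s(o, v) ∈ ω ∧ s(v, u) ∈ ω ∧ (openGraph (offZ {v, h} ω)).Reachable u x) := by
  rw [reach_iff_off_h hωh hou hoh huh hxh,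
    EarAtObserver.reach_iff_of_ne (o := o) (v := v) (u := u) (good_v_offZ (h := h) hωv) hov huv hxv,
    offZ_offZ, mem_offZ_singleton_iff (by rw [Sym2.mem_iff, not_or]; exact ⟨hoh.symm, hvh.symm⟩),
    mem_offZ_singleton_iff (by rw [Sym2.mem_iff, not_or]; exact ⟨hvh.symm, huh.symm⟩)]

/-- **The vertex `u`.**  `o ↔ u ⟺ (s(o,v) ∈ ω ∧ s(v,u) ∈ ω) ∨ o ~ u off Z`. [this work] -/
theorem reach_u_iff : (openGraph ω).Reachable o u ↔
    (s(o, v) ∈ ω ∧ s(v, u) ∈ ω) ∨ (openGraph (offZ {v, h} ω)).Reachable o u := by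
  rw [reach_iff_of_ne hωv hωh hov huv hou hoh huh hvh huv huh]
  constructor
  · rintro (h' | ⟨hp, hr, -⟩)
    · exact Or.inr h'
    · exact Or.inl ⟨hp, hr⟩
  · rintro (⟨hp, hr⟩ | h')
    · exact Or.inr ⟨hp, hr, SimpleGraph.Reachable.refl _⟩
    · exact Or.inl h'

/-- **The relay `v`.**  `o ↔ v ⟺ s(o,v) ∈ ω ∨ (s(v,u) ∈ ω ∧ o ~ u off Z)`. [this work] -/
theorem reach_v_iff : (openGraph ω).Reachable o v ↔
    s(o, v) ∈ ω ∨ (s(v, u) ∈ ω ∧ (openGraph (offZ {v, h} ω)).Reachable o u) := by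
  rw [reach_iff_off_h hωh hou hoh huh hvh,
    EarAtObserver.reach_v_iff (o := o) (v := v) (u := u) (good_v_offZ (h := h) hωv) hov huv,
    offZ_offZ, mem_offZ_singleton_iff (by rw [Sym2.mem_iff, not_or]; exact ⟨hoh.symm, hvh.symm⟩),
    mem_offZ_singleton_iff (by rw [Sym2.mem_iff, not_or]; exact ⟨hvh.symm, huh.symm⟩)]

/-- **The hair relay `h`.**  `o ↔ h ⟺ s(u,h) ∈ ω ∧ (o ~ u off Z ∨ (s(o,v) ∈ ω ∧ s(v,u) ∈ ω))`. [this work] -/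
theorem reach_h_iff : (openGraph ω).Reachable o h ↔
    s(u, h) ∈ ω ∧ ((openGraph (offZ {v, h} ω)).Reachable o u ∨ (s(o, v) ∈ ω ∧ s(v, u) ∈ ω)) := by
  rw [EarAtObserver.reach_v_iff (o := o) (v := h) (u := u) (good_h (o := o) hωh) hoh huh]
  have hu : (openGraph (offZ {h} ω)).Reachable o u ↔
      (s(o, v) ∈ ω ∧ s(v, u) ∈ ω) ∨ (openGraph (offZ {v, h} ω)).Reachable o u := by
    rw [EarAtObserver.reach_u_iff (o := o) (v := v) (u := u) (good_v_offZ (h := h) hωv) hov huv,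
      offZ_offZ, mem_offZ_singleton_iff (by rw [Sym2.mem_iff, not_or]; exact ⟨hoh.symm, hvh.symm⟩),
      mem_offZ_singleton_iff (by rw [Sym2.mem_iff, not_or]; exact ⟨hvh.symm, huh.symm⟩)]
  rw [hu, Sym2.eq_swap (a := h) (b := u)]
  constructor
  · rintro (hp | ⟨hs, h'⟩)
    · exact absurd hp (not_mem_oh hωh hou hoh)
    · exact ⟨hs, h'.symm⟩
  · rintro ⟨hs, h'⟩
    exact Or.inr ⟨hs, h'.symm⟩

/-! ## The relay count -/

/-- On a good configuration the outside relays reached by `o` are those reached off `Z`, plus — when both pairs at `v` are open —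
the feedback relays (`o ≁ b`, `u ~ b off Z`): `#{b ∈ A″ : o ↔ b} = K + [s(o,v), s(v,u) open]·F`. [this work] -/
theorem card_out_eq (A : Finset (Fin n)) :
    (((A.erase v).erase h).filter fun a => ω ∈ openConn o a).card =
      (((A.erase v).erase h).filter fun a => offZ {v, h} ω ∈ openConn o a).card +
        (if s(o, v) ∈ ω ∧ s(v, u) ∈ ω then
          (((A.erase v).erase h).filter fun b => ¬ (openGraph (offZ {v, h} ω)).Reachable o b ∧
            (openGraph (offZ {v, h} ω)).Reachable u b).card else 0) := by
  set A'' := (A.erase v).erase h with hA''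
  have hmem : ∀ b ∈ A'', b ≠ v ∧ b ≠ h := fun b hb =>
    ⟨(mem_erase.1 (mem_erase.1 hb).2).1, (mem_erase.1 hb).1⟩
  by_cases hT : s(o, v) ∈ ω ∧ s(v, u) ∈ ω
  · rw [if_pos hT]
    have hsplit : (A''.filter fun a => ω ∈ openConn o a) =
        (A''.filter fun a => offZ {v, h} ω ∈ openConn o a) ∪
          (A''.filter fun b => ¬ (openGraph (offZ {v, h} ω)).Reachable o b ∧ (openGraph (offZ {v, h} ω)).Reachable u b) := by
      ext b
      simp only [mem_filter, mem_union]
      constructor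
      · rintro ⟨hb, hr⟩
        have hr' : (openGraph ω).Reachable o b := hr
        rcases (reach_iff_of_ne hωv hωh hov huv hou hoh huh hvh (hmem b hb).1 (hmem b hb).2).1 hr' with h1 | ⟨-, -, h1⟩
        · exact Or.inl ⟨hb, h1⟩
        · by_cases hob : (openGraph (offZ {v, h} ω)).Reachable o b
          · exact Or.inl ⟨hb, hob⟩
          · exact Or.inr ⟨hb, hob, h1⟩
      · rintro (⟨hb, h1⟩ | ⟨hb, -, h1⟩)
        · exact ⟨hb, reachable_of_offZ h1⟩
        · exact ⟨hb, (reach_iff_of_ne hωv hωh hov huv hou hoh huh hvh (hmem b hb).1 (hmem b hb).2).2 (Or.inr ⟨hT.1, hT.2, h1⟩)⟩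
    rw [hsplit, card_union_of_disjoint]
    rw [disjoint_filter]
    intro b _ h1 h2
    exact h2.1 h1
  · rw [if_neg hT, add_zero]
    congr 1
    refine filter_congr fun b hb => ?_
    show (openGraph ω).Reachable o b ↔ (openGraph (offZ {v, h} ω)).Reachable o b
    rw [reach_iff_of_ne hωv hωh hov huv hou hoh huh hvh (hmem b hb).1 (hmem b hb).2]
    constructor
    · rintro (h1 | ⟨hp, hr, -⟩)
      · exact h1
      · exact absurd ⟨hp, hr⟩ hT
    · exact fun h1 => Or.inl h1

/-- **The observer's relay count on a good configuration** (`v, h ∈ A`):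
`N = [s(o,v) ∨ (s(v,u) ∧ G)] + [s(u,h) ∧ (G ∨ (s(o,v) ∧ s(v,u)))] + K + [s(o,v) ∧ s(v,u)]·F`. [this work] -/
theorem card_eq {A : Finset (Fin n)} (hvA : v ∈ A) (hhA : h ∈ A) :
    (A.filter fun a => ω ∈ openConn o a).card =
      (if s(o, v) ∈ ω ∨ (s(v, u) ∈ ω ∧ (openGraph (offZ {v, h} ω)).Reachable o u) then 1 else 0) +
      (if s(u, h) ∈ ω ∧ ((openGraph (offZ {v, h} ω)).Reachable o u ∨ (s(o, v) ∈ ω ∧ s(v, u) ∈ ω)) then 1 else 0) +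
      (((A.erase v).erase h).filter fun a => offZ {v, h} ω ∈ openConn o a).card +
      (if s(o, v) ∈ ω ∧ s(v, u) ∈ ω then
        (((A.erase v).erase h).filter fun b => ¬ (openGraph (offZ {v, h} ω)).Reachable o b ∧
          (openGraph (offZ {v, h} ω)).Reachable u b).card else 0) := by
  have hhA' : h ∈ A.erase v := mem_erase.2 ⟨hvh.symm, hhA⟩
  rw [EarAtObserver.card_filter_eq_ite_add (o := o) hvA, EarAtObserver.card_filter_eq_ite_add (o := o) hhA',
    card_out_eq hωv hωh hov huv hou hoh huh hvh A]
  have e1 : (ω ∈ openConn o v) = (openGraph ω).Reachable o v := rfl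
  have e2 : (ω ∈ openConn o h) = (openGraph ω).Reachable o h := rfl
  simp only [e1, e2, reach_v_iff hωv hωh hov huv hou hoh huh hvh, reach_h_iff hωv hωh hov huv hou hoh huh hvh]
  ring

end Good

/-! ## The pointwise first-moment bound (any configuration, no goodness needed) -/

/-- On `G = [o ~ u]` there are no feedback relays. [this work] -/
theorem feed_eq_zero_of_reach (η : BondConfig (Fin n)) (B : Finset (Fin n)) (hG : (openGraph η).Reachable o u) :
    (B.filter fun b => ¬ (openGraph η).Reachable o b ∧ (openGraph η).Reachable u b).card = 0 := by
  rw [card_eq_zero, filter_eq_empty_iff]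
  rintro b - ⟨h1, h2⟩
  exact h1 (hG.trans h2)

/-- The relays reached by `o` and the feedback relays are disjoint: `K + F ≤ |B|`. [this work] -/
theorem reach_add_feed_le (η : BondConfig (Fin n)) (B : Finset (Fin n)) :
    (B.filter fun a => η ∈ openConn o a).card +
      (B.filter fun b => ¬ (openGraph η).Reachable o b ∧ (openGraph η).Reachable u b).card ≤ B.card := by
  rw [← card_union_of_disjoint]
  · exact card_le_card (union_subset (filter_subset _ _) (filter_subset _ _))
  · rw [disjoint_filter]
    intro b _ h1 h2
    exact h2.1 h1

/-- **Pointwise first-moment bound.**  With `K = #{b ∈ B : o ~ b}`, `F = #{b ∈ B : o ≁ b, u ~ b}`, `G = [o ~ u]`, `n = |B|`, `0 ≤ π ≤ 1`: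
`K + π F ≤ π n·[¬G, K = 0, 1 ≤ F] + (1 − π + π n)·[¬G, K = 1] + n·[¬G, 2 ≤ K] + [G, K = 1] + n·[G, 2 ≤ K]`. [this work] -/
theorem count_le (η : BondConfig (Fin n)) (B : Finset (Fin n)) {π : ℝ} (hπ0 : 0 ≤ π) (hπ1 : π ≤ 1) :
    ((B.filter fun a => η ∈ openConn o a).card : ℝ) +
        π * (B.filter fun b => ¬ (openGraph η).Reachable o b ∧ (openGraph η).Reachable u b).card ≤
      π * B.card * (if ¬ (openGraph η).Reachable o u ∧ (B.filter fun a => η ∈ openConn o a).card = 0 ∧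
          1 ≤ (B.filter fun b => ¬ (openGraph η).Reachable o b ∧ (openGraph η).Reachable u b).card then (1 : ℝ) else 0) +
      (1 - π + π * B.card) * (if ¬ (openGraph η).Reachable o u ∧ (B.filter fun a => η ∈ openConn o a).card = 1 then (1 : ℝ) else 0) +
      B.card * (if ¬ (openGraph η).Reachable o u ∧ 2 ≤ (B.filter fun a => η ∈ openConn o a).card then (1 : ℝ) else 0) +
      (if (openGraph η).Reachable o u ∧ (B.filter fun a => η ∈ openConn o a).card = 1 then (1 : ℝ) else 0) +
      B.card * (if (openGraph η).Reachable o u ∧ 2 ≤ (B.filter fun a => η ∈ openConn o a).card then (1 : ℝ) else 0) := by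
  set K := (B.filter fun a => η ∈ openConn o a).card with hK
  set F := (B.filter fun b => ¬ (openGraph η).Reachable o b ∧ (openGraph η).Reachable u b).card with hF
  have hKF : K + F ≤ B.card := reach_add_feed_le (o := o) (u := u) η B
  have hKF' : (K : ℝ) + F ≤ B.card := by exact_mod_cast hKF
  have hF0 : (0 : ℝ) ≤ F := Nat.cast_nonneg _
  have hK0 : (0 : ℝ) ≤ K := Nat.cast_nonneg _
  have hB0 : (0 : ℝ) ≤ B.card := Nat.cast_nonneg _
  have hπF : π * (F : ℝ) ≤ F := by nlinarith
  by_cases hG : (openGraph η).Reachable o u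
  · have hF00 : F = 0 := feed_eq_zero_of_reach (o := o) (u := u) η B hG
    have hFr : (F : ℝ) = 0 := by exact_mod_cast hF00
    have n1 : ¬ (¬ (openGraph η).Reachable o u ∧ K = 0 ∧ 1 ≤ F) := fun h' => h'.1 hG
    have n2 : ¬ (¬ (openGraph η).Reachable o u ∧ K = 1) := fun h' => h'.1 hG
    have n3 : ¬ (¬ (openGraph η).Reachable o u ∧ 2 ≤ K) := fun h' => h'.1 hG
    rw [if_neg n1, if_neg n2, if_neg n3, hFr]
    by_cases h1 : K = 1
    · have n5 : ¬ ((openGraph η).Reachable o u ∧ 2 ≤ K) := fun h' => by omega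
      have e : (K : ℝ) = 1 := by exact_mod_cast h1
      rw [if_pos ⟨hG, h1⟩, if_neg n5, e]
      linarith
    · have n4 : ¬ ((openGraph η).Reachable o u ∧ K = 1) := fun h' => h1 h'.2
      rw [if_neg n4]
      by_cases h2 : 2 ≤ K
      · rw [if_pos ⟨hG, h2⟩]
        nlinarith
      · have n5 : ¬ ((openGraph η).Reachable o u ∧ 2 ≤ K) := fun h' => h2 h'.2
        have e : (K : ℝ) = 0 := by exact_mod_cast (show K = 0 by omega)
        rw [if_neg n5, e]
        linarith
  · have n4 : ¬ ((openGraph η).Reachable o u ∧ K = 1) := fun h' => hG h'.1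
    have n5 : ¬ ((openGraph η).Reachable o u ∧ 2 ≤ K) := fun h' => hG h'.1
    rw [if_neg n4, if_neg n5]
    by_cases h0 : K = 0
    · have e : (K : ℝ) = 0 := by exact_mod_cast h0
      have n2 : ¬ (¬ (openGraph η).Reachable o u ∧ K = 1) := fun h' => by omega
      have n3 : ¬ (¬ (openGraph η).Reachable o u ∧ 2 ≤ K) := fun h' => by omega
      rw [if_neg n2, if_neg n3, e]
      by_cases hF1 : 1 ≤ F
      · rw [if_pos ⟨hG, h0, hF1⟩]
        have : (F : ℝ) ≤ B.card := by linarith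
        nlinarith
      · have n1 : ¬ (¬ (openGraph η).Reachable o u ∧ K = 0 ∧ 1 ≤ F) := fun h' => hF1 h'.2.2
        have eF : (F : ℝ) = 0 := by exact_mod_cast (show F = 0 by omega)
        rw [if_neg n1, eF]
        linarith
    · have n1 : ¬ (¬ (openGraph η).Reachable o u ∧ K = 0 ∧ 1 ≤ F) := fun h' => h0 h'.2.1
      rw [if_neg n1]
      by_cases h1 : K = 1
      · have n3 : ¬ (¬ (openGraph η).Reachable o u ∧ 2 ≤ K) := fun h' => by omega
        have e : (K : ℝ) = 1 := by exact_mod_cast h1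
        rw [if_pos ⟨hG, h1⟩, if_neg n3, e]
        have hF' : (F : ℝ) + 1 ≤ B.card := by linarith
        nlinarith
      · have h2 : 2 ≤ K := by omega
        have n2 : ¬ (¬ (openGraph η).Reachable o u ∧ K = 1) := fun h' => h1 h'.2
        rw [if_neg n2, if_pos ⟨hG, h2⟩]
        nlinarith

end EarHair

end Quant

end Summit.CriticalPhenomena.PercolationContinuityZ3.Theorems
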